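import Summits.MatrixMultiplication.OmegaCensus.SmallFormats.MatMul22nRankGF7Slack4Search
import Summits.MatrixMultiplication.OmegaCensus.SmallFormats.MatMul22nRankGF7Slack4WLOG
import HarnessLib

/-!
# ω-census family (a): soundness of the slack-4 search checker — relations at a tight point, keys, determination (part 1)

Cell `pub-omega` (unit `pub-omega-tensor-g15`), topic `Summits/MatrixMultiplication/OmegaCensus` (sub-folder `SmallFormats`).
Framing (verbatim): lottery ticket; floor = certified bounds/negative ranges. HONEST FRAMING: kernel infrastructure (soundness lemmas for
`MatMul22nRankGF7Slack4Search`, `pub-omega-tensor-g15/KERNEL-S4-DESIGN.md` §7); nothing here is progress on `ω`.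

At an LP-tight point `x` of slack `4` write `P u = colN7 x (u/42) (u%42)` for the 882 torus-coset counts and `colPack7 x tt` for the packed
columns. This file proves: (`rel_mod7`) every certified relation `i < 809` holds: `(P u_i + Σ_t ((7 − d_{i,t}) % 7)·P f_t) % 7 = relC7 i`;
(`dot_relE7`) the checker's `dotPack10 (colPack7 x tt) (relE7 i tt)` is the part of that functional on torus `tt`; (`relPart7_eq`) `relPart7`
on the true packed columns is the functional restricted to the tori `< k` (mod 7); hence (`detCol7_val`) a computed coordinate of a torus
`jj ≥ 6` IS the true coset count and is `≤ 4`, and (`key_eq_need7`) at levels `1..5` the key of the true column equals the need.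
-/

namespace Summit.MatrixMultiplication.OmegaCensus.SmallFormats

open Finset
open Literature.NumberTheory.NumberFields (list_sum_range_map)

/-! ## Uniform relation data and facts -/

/-- Weight certificate of relation `i` (uniform access to the four data files). -/
def relW7u (i : ℕ) : ℕ := if i < 179 then relW7_1 i else if i < 347 then relW7_2 i else if i < 557 then relW7_3 i else relW7_4 i

/-- Every certified relation passes its check, with the stored constant. -/
theorem rel_facts7 {i : ℕ} (hi : i < 809) :
    relOK7 (mkRelA7 (relU7 i) (relD7 i)) (relW7u i) = true ∧ relC7 i = 4 * relConstL7 (relW7u i) % 7 := by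
  by_cases h1 : i < 179
  · have e1 : relU7 i = relU7_1 i := by simp [relU7, h1]
    have e2 : relD7 i = relD7_1 i := by funext t; simp [relD7, h1]
    have e3 : relC7 i = relC7_1 i := by simp [relC7, h1]
    have e4 : relW7u i = relW7_1 i := by simp [relW7u, h1]
    rw [e1, e2, e3, e4]; exact relOK7_1 (Nat.zero_le _) h1
  by_cases h2 : i < 347
  · have e1 : relU7 i = relU7_2 i := by simp [relU7, h1, h2]
    have e2 : relD7 i = relD7_2 i := by funext t; simp [relD7, h1, h2]
    have e3 : relC7 i = relC7_2 i := by simp [relC7, h1, h2]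
    have e4 : relW7u i = relW7_2 i := by simp [relW7u, h1, h2]
    rw [e1, e2, e3, e4]; exact relOK7_2 (by omega) h2
  by_cases h3 : i < 557
  · have e1 : relU7 i = relU7_3 i := by simp [relU7, h1, h2, h3]
    have e2 : relD7 i = relD7_3 i := by funext t; simp [relD7, h1, h2, h3]
    have e3 : relC7 i = relC7_3 i := by simp [relC7, h1, h2, h3]
    have e4 : relW7u i = relW7_3 i := by simp [relW7u, h1, h2, h3]
    rw [e1, e2, e3, e4]; exact relOK7_3 (by omega) h3
  · have e1 : relU7 i = relU7_4 i := by simp [relU7, h1, h2, h3]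
    have e2 : relD7 i = relD7_4 i := by funext t; simp [relD7, h1, h2, h3]
    have e3 : relC7 i = relC7_4 i := by simp [relC7, h1, h2, h3]
    have e4 : relW7u i = relW7_4 i := by simp [relW7u, h1, h2, h3]
    rw [e1, e2, e3, e4]; exact relOK7_4 (by omega) hi

set_option maxRecDepth 100000 in
set_option maxHeartbeats 8000000 in
/-- Table facts: dependent coordinates are `< 882` and off the free set; free coordinates lie in tori `0..5`; coefficients `< 7`. -/
theorem relU7_ok : ∀ i : Fin 809, relU7 i.val < 882 ∧ (∀ t : Fin 73, freeIdx7 t.val < relU7 i.val ∨ relU7 i.val < freeIdx7 t.val) ∧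
    ∀ t : Fin 73, freeIdx7 t.val < 252 := by
  decide +kernel

set_option maxRecDepth 100000 in
set_option maxHeartbeats 8000000 in
/-- Table facts for the determined tori: relation `relStart7 jj + z` has dependent coordinate `42·jj + z` (`6 ≤ jj < 21`, `z < 42`). -/
theorem relStart7_ok : ∀ jj : Fin 21, 6 ≤ jj.val → ∀ z : Fin 42, relStart7 jj.val + z.val < 809 ∧ relU7 (relStart7 jj.val + z.val) = 42 * jj.val + z.val := by
  decide +kernel

set_option maxRecDepth 100000 in
set_option maxHeartbeats 8000000 in
/-- Table facts for the cross relations: level offsets are monotone and `≤ 35`. -/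
theorem crossOff7_ok : ∀ j : Fin 6, 1 ≤ j.val → crossOff7 j.val ≤ crossOff7 (j.val + 1) ∧ crossOff7 (j.val + 1) ≤ 35 := by decide

set_option maxRecDepth 100000 in
set_option maxHeartbeats 8000000 in
/-- Cross relation `r` of level `j`: index `< 809`, dependent coordinate in torus `j`. -/
theorem crossRel7_lev : ∀ j : Fin 6, ∀ r : Fin 35, crossOff7 j.val ≤ r.val → r.val < crossOff7 (j.val + 1) →
    crossRel7 r.val < 809 ∧ relU7 (crossRel7 r.val) / 42 = j.val := by decide +kernel

set_option maxRecDepth 100000 in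
set_option maxHeartbeats 8000000 in
/-- Cross relation `r` of level `j`: nonzero coefficients only on free coordinates of tori `≤ j`. -/
theorem crossRel7_free : ∀ j : Fin 6, ∀ r : Fin 35, crossOff7 j.val ≤ r.val → r.val < crossOff7 (j.val + 1) →
    ∀ t : Fin 73, (7 - relD7 (crossRel7 r.val) t.val) % 7 = 0 ∨ freeIdx7 t.val / 42 ≤ j.val := by decide +kernel

/-! ## The setting: an LP-tight point -/

/-- The torus-coset count at coordinate `u`. -/
def Pc7 (x : ℕ → ℕ) (u : ℕ) : ℕ := colN7 x (u / 42) (u % 42)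

/-- Packed column of torus `tt`. -/
def colPack7 (x : ℕ → ℕ) (tt : ℕ) : ℕ := pack10 (colN7 x tt) 42

/-- **Relations hold at a tight point (mod 7), natural-number form.** -/
theorem rel_mod7 (x : ℕ → ℕ) (hT : ∀ r < 384, xrs7 x r = 4) (hR : ∀ k < 8, xrs7 x (1266 + k) = 2 * (4 : ℤ)) {i : ℕ} (hi : i < 809) :
    (Pc7 x (relU7 i) + ∑ t ∈ range 73, (7 - relD7 i t) % 7 * Pc7 x (freeIdx7 t)) % 7 = relC7 i := by
  obtain ⟨hok, hc⟩ := rel_facts7 hi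
  obtain ⟨hu882, hfree0, _⟩ := relU7_ok ⟨i, hi⟩
  have hfree1 : ∀ t : Fin 73, freeIdx7 t.val < relU7 i ∨ relU7 i < freeIdx7 t.val := hfree0
  have hfree : ∀ t : Fin 73, freeIdx7 t.val ≠ relU7 i := fun t h => by rcases hfree1 t with h' | h' <;> omega
  have hu882' : relU7 i < 882 := hu882
  have hT' : ∀ r < 384, xrs7 x r = ((4 : ℕ) : ℤ) := fun r hr => by rw [hT r hr]; rfl
  have hR' : ∀ k < 8, xrs7 x (1266 + k) = 2 * ((4 : ℕ) : ℤ) := fun k hk => by rw [hR k hk]; rfl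
  have h := rel7_of_relOK7 hok 4 x hT' hR'
  rw [relVal7_mkRelA7 hu882' (fun t ht => hfree ⟨t, ht⟩) (relD7 i) x] at h
  -- h : (xrs7 (coset u) + Σ_t c_t * xrs7 (coset f_t)) % 7 = (↑4 * ↑(relConst7 W)) % 7  (in ℤ)
  have hL : (((Pc7 x (relU7 i) + ∑ t ∈ range 73, (7 - relD7 i t) % 7 * Pc7 x (freeIdx7 t) : ℕ) : ℤ))
      = xrs7 x (cosetRow7 (relU7 i / 42) (relU7 i % 42))
        + ∑ t ∈ range 73, (((7 - relD7 i t) % 7 : ℕ) : ℤ) * xrs7 x (cosetRow7 (freeIdx7 t / 42) (freeIdx7 t % 42)) := by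
    unfold Pc7; push_cast
    rw [colN7_cast]
    exact congrArg _ (sum_congr rfl fun t _ => by rw [colN7_cast])
  have hRhs : (((4 : ℕ) : ℤ) * (relConst7 (relW7u i) : ℤ)) % 7 = ((relC7 i : ℕ) : ℤ) := by
    rw [hc, relConstL7_eq]; push_cast; try ring
  have e : ((((Pc7 x (relU7 i) + ∑ t ∈ range 73, (7 - relD7 i t) % 7 * Pc7 x (freeIdx7 t)) % 7 : ℕ) : ℤ)) = ((relC7 i : ℕ) : ℤ) := by
    rw [Int.natCast_mod, Nat.cast_ofNat, hL, h, hRhs]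
  exact_mod_cast e

/-! ## Dot products with the true columns -/

/-- Column values of an LP-tight point are `≤ 4`. -/
theorem colN7_le4 (x : ℕ → ℕ) (hrows : ∀ r < 1274, capRowVal7 x r ≤ rhs7s 4 r)
    (hge : (208 : ℤ) ≤ ∑ j ∈ range 401, (x j : ℤ)) {tt : ℕ} (htt : tt < 21) : ∀ z < 42, colN7 x tt z ≤ 4 :=
  (slack4_tight_cols7 x hrows hge htt).1

/-- **The checker's dot product on a true column** (`tt < 21`): the part of relation `i` on torus `tt`. -/
theorem dot_relE7 (x : ℕ → ℕ) (hrows : ∀ r < 1274, capRowVal7 x r ≤ rhs7s 4 r)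
    (hge : (208 : ℤ) ≤ ∑ j ∈ range 401, (x j : ℤ)) {i : ℕ} (hi : i < 809) {tt : ℕ} (htt : tt < 21) :
    dotPack10 (colPack7 x tt) (relE7 i tt) = ∑ z ∈ range 42, colN7 x tt z * relCoef7 (relU7 i) (relD7 i) (42 * tt + z) := by
  obtain ⟨_, hfree0, _⟩ := relU7_ok ⟨i, hi⟩
  have hfree1 : ∀ t : Fin 73, freeIdx7 t.val < relU7 i ∨ relU7 i < freeIdx7 t.val := hfree0
  have hfree : ∀ t : Fin 73, freeIdx7 t.val ≠ relU7 i := fun t h => by rcases hfree1 t with h' | h' <;> omega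
  unfold colPack7 relE7
  exact dot_relEv7 (fun t ht => hfree ⟨t, ht⟩) (relD7 i) tt (colN7 x tt) (colN7_le4 x hrows hge htt)

/-- The coefficient sum over the tori `< k` (`k ≤ 21`), coordinate form. -/
theorem sum_tori_coord7 (g : ℕ → ℕ) (k : ℕ) :
    ∑ tt ∈ range k, ∑ z ∈ range 42, g (42 * tt + z) = ∑ u ∈ range (42 * k), g u := by
  induction k with
  | zero => simp
  | succ k ih =>
    rw [sum_range_succ, ih, show 42 * (k + 1) = 42 * k + 42 by ring, sum_range_add]

/-- The functional restricted to coordinates `< 42 k`, written with `relCoef7`. -/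
theorem relCoef_sum7 (x : ℕ → ℕ) (i : ℕ) (k : ℕ) :
    ∑ u ∈ range (42 * k), Pc7 x u * relCoef7 (relU7 i) (relD7 i) u
      = (if relU7 i < 42 * k then Pc7 x (relU7 i) else 0)
        + ∑ t ∈ range 73, if freeIdx7 t < 42 * k then (7 - relD7 i t) % 7 * Pc7 x (freeIdx7 t) else 0 := by
  have e : ∀ u ∈ range (42 * k), Pc7 x u * relCoef7 (relU7 i) (relD7 i) u
      = (if u = relU7 i then Pc7 x u else 0) + ∑ t ∈ range 73, (if freeIdx7 t = u then (7 - relD7 i t) % 7 * Pc7 x (freeIdx7 t) else 0) := by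
    intro u _
    unfold relCoef7
    rw [mul_add, mul_sum]
    have a1 : Pc7 x u * (if u = relU7 i then 1 else 0) = if u = relU7 i then Pc7 x u else 0 := by split_ifs <;> simp
    have a2 : ∀ t ∈ range 73, Pc7 x u * (if freeIdx7 t = u then (7 - relD7 i t) % 7 else 0)
        = if freeIdx7 t = u then (7 - relD7 i t) % 7 * Pc7 x (freeIdx7 t) else 0 := by
      intro t _
      by_cases h : freeIdx7 t = u
      · rw [if_pos h, if_pos h, h, mul_comm]
      · rw [if_neg h, if_neg h, mul_zero]
    rw [a1, sum_congr rfl a2]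
  rw [sum_congr rfl e, sum_add_distrib]
  have p1 : ∑ u ∈ range (42 * k), (if u = relU7 i then Pc7 x u else 0) = if relU7 i < 42 * k then Pc7 x (relU7 i) else 0 := by
    rw [sum_ite_eq' (range (42 * k)) (relU7 i)]; simp only [mem_range]
  have p2 : ∑ u ∈ range (42 * k), ∑ t ∈ range 73, (if freeIdx7 t = u then (7 - relD7 i t) % 7 * Pc7 x (freeIdx7 t) else 0)
      = ∑ t ∈ range 73, if freeIdx7 t < 42 * k then (7 - relD7 i t) % 7 * Pc7 x (freeIdx7 t) else 0 := by
    rw [sum_comm]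
    refine sum_congr rfl fun t _ => ?_
    rw [sum_ite_eq (range (42 * k)) (freeIdx7 t)]; simp only [mem_range]
  rw [p1, p2]

/-- Reading an entry of a mapped range, any default (generic in `f`, so that the kernel never unfolds the packed columns). -/
theorem getD_map_range7 (f : ℕ → ℕ) {k tt d : ℕ} (htt : tt < k) : ((List.range k).map f).getD tt d = f tt := by
  rw [List.getD_eq_getElem?_getD, List.getElem?_map, List.getElem?_range htt]; rfl

/-- Reading a packed column out of the column list. -/
theorem cols_getD7 (x : ℕ → ℕ) {k tt : ℕ} (htt : tt < k) : ((List.range k).map (colPack7 x)).getD tt 0 = colPack7 x tt :=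
  getD_map_range7 (colPack7 x) htt

/-- `relPart7` as a `Finset` sum. -/
theorem relPart7_unfold (i k : ℕ) (cols : List ℕ) :
    relPart7 i k cols = (∑ tt ∈ range k, dotPack10 (cols.getD tt 0) (relE7 i tt)) % 7 := by
  unfold relPart7; rw [list_sum_range_map]

/-- **`relPart7` on the true packed columns** (`k ≤ 21`): the functional of relation `i` restricted to the tori `< k`, mod 7. -/
theorem relPart7_eq (x : ℕ → ℕ) (hrows : ∀ r < 1274, capRowVal7 x r ≤ rhs7s 4 r)
    (hge : (208 : ℤ) ≤ ∑ j ∈ range 401, (x j : ℤ)) {i : ℕ} (hi : i < 809) {k : ℕ} (hk : k ≤ 21) :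
    relPart7 i k ((List.range k).map (colPack7 x))
      = ((if relU7 i < 42 * k then Pc7 x (relU7 i) else 0)
          + ∑ t ∈ range 73, if freeIdx7 t < 42 * k then (7 - relD7 i t) % 7 * Pc7 x (freeIdx7 t) else 0) % 7 := by
  rw [relPart7_unfold, ← relCoef_sum7 x i k, ← sum_tori_coord7 (fun u => Pc7 x u * relCoef7 (relU7 i) (relD7 i) u) k]
  have e : ∀ tt ∈ range k, dotPack10 (((List.range k).map (colPack7 x)).getD tt 0) (relE7 i tt)
      = ∑ z ∈ range 42, Pc7 x (42 * tt + z) * relCoef7 (relU7 i) (relD7 i) (42 * tt + z) := by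
    intro tt htt
    have htt' := mem_range.1 htt
    rw [cols_getD7 x htt', dot_relE7 x hrows hge hi (by omega)]
    refine sum_congr rfl fun z hz => ?_
    have hz' := mem_range.1 hz
    have e1 : (42 * tt + z) / 42 = tt := by omega
    have e2 : (42 * tt + z) % 42 = z := by omega
    unfold Pc7; rw [e1, e2]
  rw [sum_congr rfl e]

/-! ## Determination: computed coordinates are the true ones -/

/-- For a relation of a torus `jj ≥ 6` (all free coordinates in tori `< 6`, the dependent one outside), the need at `k = 6` is the true
coset count, which is therefore `≤ 4`. -/
theorem detCoord7_eq (x : ℕ → ℕ) (hrows : ∀ r < 1274, capRowVal7 x r ≤ rhs7s 4 r)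
    (hge : (208 : ℤ) ≤ ∑ j ∈ range 401, (x j : ℤ)) {jj : ℕ} (hjj : 6 ≤ jj) (hjj21 : jj < 21) {z : ℕ} (hz : z < 42) :
    relNeed7 (relStart7 jj + z) 6 ((List.range 6).map (colPack7 x)) = colN7 x jj z := by
  obtain ⟨_, hT, hR, _, _⟩ := tight7_of_total_ge 4 x hrows (by push_cast; linarith)
  obtain ⟨hi0, hu0⟩ := relStart7_ok ⟨jj, hjj21⟩ hjj ⟨z, hz⟩
  have hi : relStart7 jj + z < 809 := hi0
  have hu : relU7 (relStart7 jj + z) = 42 * jj + z := hu0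
  obtain ⟨_, _, hf0⟩ := relU7_ok ⟨relStart7 jj + z, hi⟩
  have hf252 : ∀ t < 73, freeIdx7 t < 252 := fun t ht => hf0 ⟨t, ht⟩
  have hmod := rel_mod7 x (fun r hr => by exact_mod_cast hT r hr) (fun k hk => by exact_mod_cast hR k hk) hi
  have hpart := relPart7_eq x hrows hge hi (k := 6) (by norm_num)
  have hu' : ¬ relU7 (relStart7 jj + z) < 42 * 6 := by rw [hu]; omega
  rw [if_neg hu', zero_add] at hpart
  rw [sum_congr rfl fun t ht => by rw [if_pos (by have := hf252 t (mem_range.1 ht); omega)]] at hpart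
  have hPu : Pc7 x (relU7 (relStart7 jj + z)) = colN7 x jj z := by
    unfold Pc7; rw [hu, show (42 * jj + z) / 42 = jj by omega, show (42 * jj + z) % 42 = z by omega]
  have hle : colN7 x jj z ≤ 4 := colN7_le4 x hrows hge hjj21 z hz
  rw [hPu] at hmod
  unfold relNeed7
  rw [hpart]
  have hC7 : relC7 (relStart7 jj + z) < 7 := by rw [← hmod]; exact Nat.mod_lt _ (by norm_num)
  omega

end Summit.MatrixMultiplication.OmegaCensus.SmallFormats
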